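import Summits.AtomisticToContinuum.HydrodynamicLimit.Theorems.JaynesSqueezeBlockGibbsMeasurableProfiles
import Summits.AtomisticToContinuum.HydrodynamicLimit.Theorems.JaynesSqueezeHardSphereLDAMeanLimit
import HarnessLib

/-!
# General-family canonical hard-sphere laws: disintegration, position marginal, equipartition

Support file for the crux `…Theses.RelayRaceLocality.NearConstantShortTimeHL` (stmt-AtomisticToContinuum-12502),
line `means-pin-entropy`, stub `stub_ldaGeneralFamilies : GeneralFamilyLDA` (S1, local density approximation for
GENERAL diameter/number families `(ε_N, n_N)`). The crux's laws are the canonical hard-sphere laws of `n` spheres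
of diameter `ε` on `𝕋³` with a local Gibbs profile,

  `Q = (liouville 𝕋³ n ε).withDensity (ofReal ∘ canonicalDensity 𝕋³ ε n (localGibbsProfile a u θ))`,

for an ARBITRARY pair `(ε, n)` — whereas the tree's local Gibbs API (`HardSphereEulerProofs`,
`BlockGibbsLine.*'`) is written for the conjunct's `(hsDiameter σ N, N + 1)`. This file re-derives, for general
`(ε, n)` and measurable profiles `0 ≤ a ≤ A`, `0 < θ`, exactly what clause (ii) of S1 consumes:

* `liouville_withDensity_canonicalDensity` — `Q` is the same density on Lebesgue measure (the indicator of the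
  hard-sphere domain is already in `canonicalDensity`);
* `lintegral_canonicalLaw` — disintegration: positions `~ Z⁻¹ 𝟙 ∏ a(xᵢ) dx`, velocities independent Gaussians
  `N(u(xᵢ), θ(xᵢ) I₃)` given the positions (`BlockGibbsLine.lintegral_gibbsWeight_mul'`);
* `canonicalLaw_univ`, `isProbabilityMeasure_canonicalLaw` — normalisation once `Z_pos > 0`;
* `integral_avg_positions_canonicalLaw` — the `Q`-mean of a bounded one-body POSITION average
  `n⁻¹ ∑ᵢ A(xᵢ)` is the canonical Gibbs mean `Z⁻¹ ∫ 𝟙 ∏ a(xᵢ) · n⁻¹ ∑ᵢ A(xᵢ) dx`;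
* `lintegral_sum_norm_sub_sq_div_velMeasure`, `integral_sum_norm_sub_sq_div_canonicalLaw` — equipartition
  `E_Q[∑ᵢ ‖vᵢ − u(xᵢ)‖²/(2θ(xᵢ))] = n · 3/2` (the centred Gaussian second moment `3θ` on `ℝ³`);
* `integral_logProfileMean_canonicalLaw` — hence for `Λ(x,v) = A(x) − ‖v − u(x)‖²/(2θ(x))` the empirical mean
  `∫ Λ d(emp z)` is `Q`-integrable with `E_Q[∫ Λ d emp] = E_a[n⁻¹ ∑ A(xᵢ)] − 3/2` (`n ≥ 1`).

No definitions. References: H. Spohn, *Large Scale Dynamics of Interacting Particles* (1991), Part I §2.3.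
-/

noncomputable section

namespace Summit.AtomisticToContinuum.HydrodynamicLimit.Theorems.NearConstantShortTimeHL

open scoped BigOperators ENNReal
open MeasureTheory Set Filter Topology
open Literature.MathematicalPhysics.KineticTheory Literature.Analysis.FluidPDE Literature.Analysis.FunctionSpaces
open Summit.AtomisticToContinuum.HydrodynamicLimit.Theorems.BlockGibbsLine
open Summit.AtomisticToContinuum.HydrodynamicLimit.Theorems.HardSphereLDA

variable {a₀ θ₀ : T3 → ℝ} {u₀ : T3 → V3}

/-! ## The law on the Liouville measure is the law on Lebesgue measure -/

/-- The canonical law on the Liouville measure `dz|_{D_ε}` is the same density on Lebesgue measure: the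
indicator of the hard-sphere domain is already part of `canonicalDensity`. [folklore] -/
theorem liouville_withDensity_canonicalDensity (ε : ℝ) (n : ℕ) (f : T3 × V3 → ℝ) :
    (liouville (Torus.geometry (Fin 3)) n ε).withDensity
        (fun z => ENNReal.ofReal (canonicalDensity (Torus.geometry (Fin 3)) ε n f z)) =
      volume.withDensity fun z => ENNReal.ofReal (canonicalDensity (Torus.geometry (Fin 3)) ε n f z) := by
  rw [liouville_eq, ← withDensity_indicator
    (measurableSet_hardSphereDomain _ Torus.measurable_geometry_sepVec n ε)]
  congr 1
  funext z
  by_cases hz : z ∈ hardSphereDomain (Torus.geometry (Fin 3)) n ε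
  · rw [indicator_of_mem hz]
  · rw [indicator_of_notMem hz, canonicalDensity_eq_zero_of_notMem _ _ _ _ hz, ENNReal.ofReal_zero]

/-! ## Disintegration into positions and velocities -/

-- adapted from `BlockGibbsLine.lintegral_localGibbsMeasure'` (conjunct family `(hsDiameter σ N, N + 1)`)
/-- **Disintegration of the canonical law** for general `(ε, n)` (measurable profiles, `a ≥ 0`, `θ > 0`): for
measurable `G ≥ 0`, `∫ G dQ = ∫ dx Z⁻¹ 𝟙_{no overlap}(x) ∏ a(xᵢ) ∫ G(x, v) ⊗ᵢ N(u(xᵢ), θ(xᵢ))(dv)`, with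
`Z = posPartition a ε n`. [folklore] -/
theorem lintegral_canonicalLaw (ha : Measurable a₀) (hθ : Measurable θ₀) (hu : Measurable u₀)
    (ha0 : ∀ x, 0 ≤ a₀ x) (hθ0 : ∀ x, 0 < θ₀ x) (ε : ℝ) (n : ℕ)
    {G : Config n (Fin 3) T3 → ℝ≥0∞} (hG : Measurable G) :
    ∫⁻ z, G z ∂(volume.withDensity fun z => ENNReal.ofReal
        (canonicalDensity (Torus.geometry (Fin 3)) ε n (localGibbsProfile a₀ u₀ θ₀) z)) =
      ∫⁻ x, ENNReal.ofReal ((posPartition a₀ ε n)⁻¹ * posWeight a₀ ε n x) *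
        ∫⁻ v, G (zipConfig (x, v)) ∂velMeasure u₀ θ₀ x := by
  set Z := canonicalPartition (Torus.geometry (Fin 3)) ε n (localGibbsProfile a₀ u₀ θ₀) with hZ
  have hZeq : Z = posPartition a₀ ε n := canonicalPartition_eq_posPartition' ha hθ hu ha0 hθ0 ε n
  have hZ0 : 0 ≤ Z⁻¹ :=
    inv_nonneg.2 (canonicalPartition_nonneg _ _ _ (localGibbsProfile_nonneg ha0 fun x => (hθ0 x).le))
  have hDm : Measurable fun z => ENNReal.ofReal
      (canonicalDensity (Torus.geometry (Fin 3)) ε n (localGibbsProfile a₀ u₀ θ₀) z) :=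
    (measurable_canonicalDensity ε n (measurable_localGibbsProfile' ha hθ hu)).ennreal_ofReal
  rw [← hZeq]
  calc ∫⁻ z, G z ∂(volume.withDensity fun z => ENNReal.ofReal
        (canonicalDensity (Torus.geometry (Fin 3)) ε n (localGibbsProfile a₀ u₀ θ₀) z))
      = ∫⁻ z, ENNReal.ofReal (canonicalDensity (Torus.geometry (Fin 3)) ε n
          (localGibbsProfile a₀ u₀ θ₀) z) * G z := by
        rw [lintegral_withDensity_eq_lintegral_mul _ hDm hG]
        rfl
    _ = ENNReal.ofReal Z⁻¹ * ∫⁻ z, ENNReal.ofReal ((hardSphereDomain (Torus.geometry (Fin 3))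
          n ε).indicator (tensorPow n (localGibbsProfile a₀ u₀ θ₀)) z) * G z := by
        rw [← lintegral_const_mul' _ _ ENNReal.ofReal_ne_top]
        refine lintegral_congr fun z => ?_
        rw [canonicalDensity, ENNReal.ofReal_mul hZ0, mul_assoc]
    _ = ENNReal.ofReal Z⁻¹ * ∫⁻ x, ENNReal.ofReal (posWeight a₀ ε n x) *
          ∫⁻ v, G (zipConfig (x, v)) ∂velMeasure u₀ θ₀ x := by
        rw [lintegral_gibbsWeight_mul' ha hθ hu ha0 hθ0 ε n hG]
    _ = _ := by
        rw [← lintegral_const_mul' _ _ ENNReal.ofReal_ne_top]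
        refine lintegral_congr fun x => ?_
        rw [ENNReal.ofReal_mul hZ0, mul_assoc]

/-! ## Normalisation -/

/-- The total mass of the canonical law is `ofReal Z⁻¹ · ofReal Z` (`Z = posPartition a ε n`; measurable profiles,
`0 ≤ a ≤ A`, `θ > 0`). [folklore] -/
theorem canonicalLaw_univ (ha : Measurable a₀) (hθ : Measurable θ₀) (hu : Measurable u₀)
    (ha0 : ∀ x, 0 ≤ a₀ x) {A : ℝ} (hA : ∀ x, a₀ x ≤ A) (hθ0 : ∀ x, 0 < θ₀ x) (ε : ℝ) (n : ℕ) :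
    (volume.withDensity fun z => ENNReal.ofReal
        (canonicalDensity (Torus.geometry (Fin 3)) ε n (localGibbsProfile a₀ u₀ θ₀) z)) univ =
      ENNReal.ofReal (posPartition a₀ ε n)⁻¹ * ENNReal.ofReal (posPartition a₀ ε n) := by
  have h := lintegral_canonicalLaw ha hθ hu ha0 hθ0 ε n (G := fun _ => 1) measurable_const
  simp only [lintegral_const, measure_univ, mul_one, one_mul] at h
  rw [h]
  simp_rw [ENNReal.ofReal_mul (inv_nonneg.2 (posPartition_nonneg ha0 _ _))]
  rw [lintegral_const_mul' _ _ ENNReal.ofReal_ne_top, ← ofReal_posPartition' ha ha0 hA]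

/-- **The canonical law is a probability measure once `Z_pos > 0`** (general `(ε, n)`, measurable profiles
`0 ≤ a ≤ A`, `θ > 0`). [folklore] -/
theorem isProbabilityMeasure_canonicalLaw (ha : Measurable a₀) (hθ : Measurable θ₀) (hu : Measurable u₀)
    (ha0 : ∀ x, 0 ≤ a₀ x) {A : ℝ} (hA : ∀ x, a₀ x ≤ A) (hθ0 : ∀ x, 0 < θ₀ x) {ε : ℝ} {n : ℕ}
    (hZ : 0 < posPartition a₀ ε n) :
    IsProbabilityMeasure (volume.withDensity fun z => ENNReal.ofReal
        (canonicalDensity (Torus.geometry (Fin 3)) ε n (localGibbsProfile a₀ u₀ θ₀) z)) := by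
  refine ⟨?_⟩
  rw [canonicalLaw_univ ha hθ hu ha0 hA hθ0 ε n, ← ENNReal.ofReal_mul (inv_nonneg.2 hZ.le),
    inv_mul_cancel₀ hZ.ne', ENNReal.ofReal_one]

/-! ## The position marginal and one-body position averages -/

-- adapted from `HardSphereLDA.map_positions_localGibbsLaw` (conjunct family)
/-- **The position marginal of the canonical law is the configurational Gibbs measure**
`posGibbsMeasure a ε n = Z⁻¹ 𝟙_{no overlap} ∏ a(xᵢ) dx` (general `(ε, n)`). [folklore] -/
theorem map_positions_canonicalLaw (ha : Measurable a₀) (hθ : Measurable θ₀) (hu : Measurable u₀)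
    (ha0 : ∀ x, 0 ≤ a₀ x) (hθ0 : ∀ x, 0 < θ₀ x) (ε : ℝ) (n : ℕ) :
    (volume.withDensity fun z => ENNReal.ofReal
        (canonicalDensity (Torus.geometry (Fin 3)) ε n (localGibbsProfile a₀ u₀ θ₀) z)).map
        (fun z i => (z i).1) = posGibbsMeasure a₀ ε n := by
  have hposm : Measurable (fun z : Config n (Fin 3) T3 => fun i => (z i).1) :=
    measurable_pi_lambda _ fun i => (measurable_pi_apply i).fst
  ext S hS
  rw [Measure.map_apply hposm hS, ← lintegral_indicator_one (hposm hS),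
    lintegral_canonicalLaw ha hθ hu ha0 hθ0 ε n (measurable_one.indicator (hposm hS)),
    posGibbsMeasure, withDensity_apply _ hS, ← lintegral_indicator hS]
  refine lintegral_congr fun x => ?_
  have hind : ∀ v : Fin n → V3,
      ((fun z : Config n (Fin 3) T3 => fun i => (z i).1) ⁻¹' S).indicator
        (1 : Config n (Fin 3) T3 → ℝ≥0∞) (zipConfig (x, v)) = S.indicator 1 x := by
    intro v
    by_cases hx : x ∈ S
    · rw [Set.indicator_of_mem hx, Set.indicator_of_mem (show zipConfig (x, v) ∈ _ from hx)]
      rfl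
    · rw [Set.indicator_of_notMem hx, Set.indicator_of_notMem (show zipConfig (x, v) ∉ _ from hx)]
  simp_rw [hind, lintegral_const, measure_univ, mul_one]
  by_cases hx : x ∈ S
  · simp [hx]
  · simp [hx]

/-- **The `Q`-mean of a position observable is its configurational Gibbs mean**: for a measurable
`F : (𝕋³)ⁿ → ℝ`, `∫ F(x(z)) dQ(z) = Z⁻¹ ∫ 𝟙 ∏ a(xᵢ) F(x) dx`. [folklore] -/
theorem integral_comp_positions_canonicalLaw (ha : Measurable a₀) (hθ : Measurable θ₀) (hu : Measurable u₀)
    (ha0 : ∀ x, 0 ≤ a₀ x) (hθ0 : ∀ x, 0 < θ₀ x) (ε : ℝ) (n : ℕ) {F : (Fin n → T3) → ℝ}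
    (hF : Measurable F) :
    ∫ z, F (fun i => (z i).1) ∂(volume.withDensity fun z => ENNReal.ofReal
        (canonicalDensity (Torus.geometry (Fin 3)) ε n (localGibbsProfile a₀ u₀ θ₀) z)) =
      (posPartition a₀ ε n)⁻¹ * ∫ x, posWeight a₀ ε n x * F x := by
  have hposm : Measurable (fun z : Config n (Fin 3) T3 => fun i => (z i).1) :=
    measurable_pi_lambda _ fun i => (measurable_pi_apply i).fst
  rw [← integral_posGibbsMeasure ha ha0 ε n F, ← map_positions_canonicalLaw ha hθ hu ha0 hθ0 ε n,
    integral_map hposm.aemeasurable hF.aestronglyMeasurable]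

/-- **The `Q`-mean of the empirical average of a one-body position observable** `A`:
`∫ n⁻¹ ∑ᵢ A(xᵢ) dQ = Z⁻¹ ∫ 𝟙 ∏ a(xᵢ) · n⁻¹ ∑ᵢ A(xᵢ) dx`. [folklore] -/
theorem integral_avg_positions_canonicalLaw (ha : Measurable a₀) (hθ : Measurable θ₀) (hu : Measurable u₀)
    (ha0 : ∀ x, 0 ≤ a₀ x) (hθ0 : ∀ x, 0 < θ₀ x) (ε : ℝ) (n : ℕ) {A : T3 → ℝ} (hAm : Measurable A) :
    ∫ z, (n : ℝ)⁻¹ * ∑ i, A (z i).1 ∂(volume.withDensity fun z => ENNReal.ofReal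
        (canonicalDensity (Torus.geometry (Fin 3)) ε n (localGibbsProfile a₀ u₀ θ₀) z)) =
      (posPartition a₀ ε n)⁻¹ * ∫ x, posWeight a₀ ε n x * ((n : ℝ)⁻¹ * ∑ i, A (x i)) :=
  integral_comp_positions_canonicalLaw ha hθ hu ha0 hθ0 ε n (F := fun x => (n : ℝ)⁻¹ * ∑ i, A (x i))
    (measurable_const.mul (measurable_sum_apply hAm))

/-! ## Equipartition: the Gaussian second moment given the positions -/

/-- **Centred second moment of an isotropic Gaussian on `ℝ³`**: `∫ ‖v − u‖² dN(u, θ I₃)(v) = 3θ` (`θ > 0`), as a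
`lintegral`. [folklore] -/
theorem lintegral_norm_sub_self_sq_gaussMeasure (u : V3) {θ : ℝ} (hθ : 0 < θ) :
    ∫⁻ v, ENNReal.ofReal (‖v - u‖ ^ 2) ∂gaussMeasure u θ = ENNReal.ofReal (3 * θ) := by
  have hint : ∫ v, ‖v - u‖ ^ 2 ∂gaussMeasure u θ = 3 * θ := by
    rw [integral_gaussMeasure u hθ]
    have hpt : ∀ w : V3, ‖u + Real.sqrt θ • w - u‖ ^ 2 = θ * ‖w‖ ^ 2 := fun w => by
      rw [add_sub_cancel_left, norm_smul, Real.norm_eq_abs, abs_of_nonneg (Real.sqrt_nonneg θ), mul_pow,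
        Real.sq_sqrt hθ.le]
    simp_rw [hpt]
    rw [integral_const_mul, integral_norm_sq_stdGaussian]
    simp
    ring
  have hi : Integrable (fun v : V3 => ‖v - u‖ ^ 2) (gaussMeasure u θ) := by
    by_contra h
    rw [integral_undef h] at hint
    linarith
  rw [← ofReal_integral_eq_lintegral_ofReal hi (ae_of_all _ fun v => sq_nonneg _), hint]

/-- **Equipartition given the positions**: under the product Gaussian velocity law `⊗ᵢ N(u(xᵢ), θ(xᵢ) I₃)`,
`∫ ∑ᵢ ‖vᵢ − u(xᵢ)‖²/(2θ(xᵢ)) = n · 3/2` (as a `lintegral`). [folklore] -/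
theorem lintegral_sum_norm_sub_sq_div_velMeasure {n : ℕ} (u₀ : T3 → V3) {θ₀ : T3 → ℝ} (hθ0 : ∀ y, 0 < θ₀ y)
    (x : Fin n → T3) :
    ∫⁻ v, ENNReal.ofReal (∑ i, (2 * θ₀ (x i))⁻¹ * ‖v i - u₀ (x i)‖ ^ 2) ∂velMeasure u₀ θ₀ x =
      ENNReal.ofReal ((n : ℝ) * (3 / 2)) := by
  have hκ : ∀ i, 0 ≤ (2 * θ₀ (x i))⁻¹ := fun i => inv_nonneg.2 (mul_nonneg zero_le_two (hθ0 _).le)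
  have hpt : ∀ v : Fin n → V3, ENNReal.ofReal (∑ i, (2 * θ₀ (x i))⁻¹ * ‖v i - u₀ (x i)‖ ^ 2) =
      ∑ i, ENNReal.ofReal ((2 * θ₀ (x i))⁻¹ * ‖v i - u₀ (x i)‖ ^ 2) := fun v =>
    ENNReal.ofReal_sum_of_nonneg fun i _ => mul_nonneg (hκ i) (sq_nonneg _)
  simp_rw [hpt]
  rw [lintegral_finsetSum _ fun i _ => ?_]
  · have hterm : ∀ i : Fin n, ∫⁻ v, ENNReal.ofReal ((2 * θ₀ (x i))⁻¹ * ‖v i - u₀ (x i)‖ ^ 2) ∂velMeasure u₀ θ₀ x =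
        ENNReal.ofReal (3 / 2) := by
      intro i
      have hf : Measurable fun w : V3 => ENNReal.ofReal ((2 * θ₀ (x i))⁻¹ * ‖w - u₀ (x i)‖ ^ 2) := by fun_prop
      have h := (measurePreserving_eval (fun j => gaussMeasure (u₀ (x j)) (θ₀ (x j))) i).lintegral_comp hf
      simp only [Function.eval] at h
      rw [velMeasure, h]
      have hpt' : ∀ w : V3, ENNReal.ofReal ((2 * θ₀ (x i))⁻¹ * ‖w - u₀ (x i)‖ ^ 2) =
          ENNReal.ofReal ((2 * θ₀ (x i))⁻¹) * ENNReal.ofReal (‖w - u₀ (x i)‖ ^ 2) := fun w => ENNReal.ofReal_mul (hκ i)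
      simp_rw [hpt']
      rw [lintegral_const_mul _ (by fun_prop), lintegral_norm_sub_self_sq_gaussMeasure _ (hθ0 _),
        ← ENNReal.ofReal_mul (hκ i)]
      congr 1
      field_simp [(hθ0 (x i)).ne']
    simp_rw [hterm]
    rw [Finset.sum_const, Finset.card_univ, Fintype.card_fin, nsmul_eq_mul, ← ENNReal.ofReal_natCast,
      ← ENNReal.ofReal_mul (Nat.cast_nonneg n)]
  · exact (measurable_const.mul (((measurable_pi_apply i).sub measurable_const).norm.pow_const 2)).ennreal_ofReal

/-- The equipartition sum `z ↦ ∑ᵢ ‖vᵢ − u(xᵢ)‖²/(2θ(xᵢ))` is measurable. [folklore] -/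
theorem measurable_sum_norm_sub_sq_div {n : ℕ} {θ : T3 → ℝ} {u : T3 → V3} (hθ : Measurable θ) (hu : Measurable u) :
    Measurable fun z : Config n (Fin 3) T3 => ∑ i, (2 * θ (z i).1)⁻¹ * ‖(z i).2 - u (z i).1‖ ^ 2 :=
  Finset.measurable_sum _ fun i _ => ((measurable_const.mul (hθ.comp (measurable_pi_apply i).fst)).inv).mul
    (((measurable_pi_apply i).snd.sub (hu.comp (measurable_pi_apply i).fst)).norm.pow_const 2)


-- adapted from `BlockGibbsLine.lintegral_sum_norm_sub_sq_div_localGibbsMeasure` (conjunct family)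
/-- **Equipartition** under the canonical law with general `(ε, n)`, as a `lintegral`:
`E_Q[∑ᵢ ‖vᵢ − u(xᵢ)‖²/(2θ(xᵢ))] = n · 3/2` when `Q` is a probability measure. [folklore] -/
theorem lintegral_sum_norm_sub_sq_div_canonicalLaw (ha : Measurable a₀) (hθ : Measurable θ₀)
    (hu : Measurable u₀) (ha0 : ∀ x, 0 ≤ a₀ x) (hθ0 : ∀ x, 0 < θ₀ x) (ε : ℝ) (n : ℕ)
    [IsProbabilityMeasure (volume.withDensity fun z => ENNReal.ofReal
        (canonicalDensity (Torus.geometry (Fin 3)) ε n (localGibbsProfile a₀ u₀ θ₀) z))] :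
    ∫⁻ z, ENNReal.ofReal (∑ i, (2 * θ₀ (z i).1)⁻¹ * ‖(z i).2 - u₀ (z i).1‖ ^ 2)
        ∂(volume.withDensity fun z => ENNReal.ofReal
          (canonicalDensity (Torus.geometry (Fin 3)) ε n (localGibbsProfile a₀ u₀ θ₀) z)) =
      ENNReal.ofReal ((n : ℝ) * (3 / 2)) := by
  have hκm : Measurable fun y => (2 * θ₀ y)⁻¹ := (measurable_const.mul hθ).inv
  have hκ0 : ∀ y, 0 ≤ (2 * θ₀ y)⁻¹ := fun y => inv_nonneg.2 (mul_nonneg zero_le_two (hθ0 y).le)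
  rw [lintegral_canonicalLaw ha hθ hu ha0 hθ0 ε n (measurable_sum_norm_sub_sq_div hθ hu).ennreal_ofReal]
  have hin : ∀ x : Fin n → T3, ∫⁻ v, ENNReal.ofReal (∑ i, (2 * θ₀ (zipConfig (x, v) i).1)⁻¹ *
      ‖(zipConfig (x, v) i).2 - u₀ (zipConfig (x, v) i).1‖ ^ 2) ∂velMeasure u₀ θ₀ x =
      ENNReal.ofReal ((n : ℝ) * (3 / 2)) := by
    intro x
    simp only [zipConfig_apply]
    exact lintegral_sum_norm_sub_sq_div_velMeasure u₀ hθ0 x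
  simp_rw [hin]
  have hρm : Measurable fun x : Fin n → T3 => ENNReal.ofReal ((posPartition a₀ ε n)⁻¹ * posWeight a₀ ε n x) :=
    (measurable_const.mul (measurable_posWeight' ha _ _)).ennreal_ofReal
  have hone : ∫⁻ x, ENNReal.ofReal ((posPartition a₀ ε n)⁻¹ * posWeight a₀ ε n x) = 1 := by
    have h := lintegral_canonicalLaw ha hθ hu ha0 hθ0 ε n (G := fun _ => 1) measurable_const
    simp only [lintegral_const, measure_univ, mul_one] at h
    exact h.symm
  rw [lintegral_mul_const _ hρm, hone, one_mul]

/-- **Bochner equipartition** under the canonical law with general `(ε, n)`: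
`∫ ∑ᵢ ‖vᵢ − u(xᵢ)‖²/(2θ(xᵢ)) dQ = n · 3/2`, and the integrand is `Q`-integrable. [folklore] -/
theorem integral_sum_norm_sub_sq_div_canonicalLaw (ha : Measurable a₀) (hθ : Measurable θ₀)
    (hu : Measurable u₀) (ha0 : ∀ x, 0 ≤ a₀ x) (hθ0 : ∀ x, 0 < θ₀ x) (ε : ℝ) (n : ℕ)
    [IsProbabilityMeasure (volume.withDensity fun z => ENNReal.ofReal
        (canonicalDensity (Torus.geometry (Fin 3)) ε n (localGibbsProfile a₀ u₀ θ₀) z))] :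
    Integrable (fun z : Config n (Fin 3) T3 => ∑ i, (2 * θ₀ (z i).1)⁻¹ * ‖(z i).2 - u₀ (z i).1‖ ^ 2)
        (volume.withDensity fun z => ENNReal.ofReal
          (canonicalDensity (Torus.geometry (Fin 3)) ε n (localGibbsProfile a₀ u₀ θ₀) z)) ∧
      ∫ z, (∑ i, (2 * θ₀ (z i).1)⁻¹ * ‖(z i).2 - u₀ (z i).1‖ ^ 2)
          ∂(volume.withDensity fun z => ENNReal.ofReal
            (canonicalDensity (Torus.geometry (Fin 3)) ε n (localGibbsProfile a₀ u₀ θ₀) z)) =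
        (n : ℝ) * (3 / 2) := by
  have hκm : Measurable fun y => (2 * θ₀ y)⁻¹ := (measurable_const.mul hθ).inv
  have hκ0 : ∀ y, 0 ≤ (2 * θ₀ y)⁻¹ := fun y => inv_nonneg.2 (mul_nonneg zero_le_two (hθ0 y).le)
  have hnn : ∀ z : Config n (Fin 3) T3, 0 ≤ ∑ i, (2 * θ₀ (z i).1)⁻¹ * ‖(z i).2 - u₀ (z i).1‖ ^ 2 :=
    fun z => Finset.sum_nonneg fun i _ => mul_nonneg (hκ0 _) (sq_nonneg _)
  have hmeas := (measurable_sum_norm_sub_sq_div (n := n) hθ hu (u := u₀))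
  have hL := lintegral_sum_norm_sub_sq_div_canonicalLaw ha hθ hu ha0 hθ0 ε n
  refine ⟨⟨hmeas.aestronglyMeasurable, ?_⟩, ?_⟩
  · rw [hasFiniteIntegral_iff_ofReal (ae_of_all _ hnn), hL]
    exact ENNReal.ofReal_lt_top
  · rw [integral_eq_lintegral_of_nonneg_ae (ae_of_all _ hnn) hmeas.aestronglyMeasurable, hL,
      ENNReal.toReal_ofReal (by positivity)]

/-! ## The mean of the empirical log-profile -/

/-- The empirical mean of `Λ(x,v) = A(x) − ‖v − u(x)‖²/(2θ(x))` splits into the position average of `A` minus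
`n⁻¹` times the equipartition sum. [folklore] -/
theorem integral_empiricalMeasure_logProfile {n : ℕ} (A θ : T3 → ℝ) (u : T3 → V3)
    (z : Config n (Fin 3) T3) :
    (∫ y, (A y.1 - ‖y.2 - u y.1‖ ^ 2 / (2 * θ y.1)) ∂(empiricalMeasure z)) =
      (n : ℝ)⁻¹ * ∑ i, A (z i).1 - (n : ℝ)⁻¹ * ∑ i, (2 * θ (z i).1)⁻¹ * ‖(z i).2 - u (z i).1‖ ^ 2 := by
  rw [integral_empiricalMeasure, Finset.sum_sub_distrib, mul_sub]
  congr 2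
  refine Finset.sum_congr rfl fun i _ => ?_
  rw [div_eq_inv_mul]

/-- **THE MEAN OF THE EMPIRICAL LOG-PROFILE.** Under the canonical law `Q` of `n ≥ 1` spheres of diameter `ε`
with profile `localGibbsProfile a u θ` (measurable, `0 ≤ a ≤ A`, `θ > 0`, `Z_pos > 0`), for a bounded measurable
`A : 𝕋³ → ℝ` and `Λ(x,v) = A(x) − ‖v − u(x)‖²/(2θ(x))`: the empirical mean `∫ Λ d(emp z)` is `Q`-integrable and
`E_Q[∫ Λ d emp] = Z⁻¹ ∫ 𝟙 ∏ a(xᵢ) · n⁻¹ ∑ A(xᵢ) dx − 3/2`. [folklore] -/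
theorem integral_logProfileMean_canonicalLaw (ha : Measurable a₀) (hθ : Measurable θ₀) (hu : Measurable u₀)
    (ha0 : ∀ x, 0 ≤ a₀ x) {Aa : ℝ} (hAa : ∀ x, a₀ x ≤ Aa) (hθ0 : ∀ x, 0 < θ₀ x) {ε : ℝ} {n : ℕ}
    (hn : 0 < n) (hZ : 0 < posPartition a₀ ε n) {A : T3 → ℝ} (hAm : Measurable A) {K : ℝ}
    (hAK : ∀ x, |A x| ≤ K) :
    Integrable (fun z : Config n (Fin 3) T3 =>
        ∫ y, (A y.1 - ‖y.2 - u₀ y.1‖ ^ 2 / (2 * θ₀ y.1)) ∂(empiricalMeasure z))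
        (volume.withDensity fun z => ENNReal.ofReal
          (canonicalDensity (Torus.geometry (Fin 3)) ε n (localGibbsProfile a₀ u₀ θ₀) z)) ∧
      ∫ z, (∫ y, (A y.1 - ‖y.2 - u₀ y.1‖ ^ 2 / (2 * θ₀ y.1)) ∂(empiricalMeasure z))
          ∂(volume.withDensity fun z => ENNReal.ofReal
            (canonicalDensity (Torus.geometry (Fin 3)) ε n (localGibbsProfile a₀ u₀ θ₀) z)) =
        ((posPartition a₀ ε n)⁻¹ * ∫ x, posWeight a₀ ε n x * ((n : ℝ)⁻¹ * ∑ i, A (x i))) - 3 / 2 := by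
  haveI := isProbabilityMeasure_canonicalLaw (u₀ := u₀) ha hθ hu ha0 hAa hθ0 hZ
  obtain ⟨hint2, hval2⟩ := integral_sum_norm_sub_sq_div_canonicalLaw (u₀ := u₀) ha hθ hu ha0 hθ0 ε n
  set Q : Measure (Config n (Fin 3) T3) := volume.withDensity fun z => ENNReal.ofReal
    (canonicalDensity (Torus.geometry (Fin 3)) ε n (localGibbsProfile a₀ u₀ θ₀) z) with hQ
  have hfun : (fun z : Config n (Fin 3) T3 =>
      ∫ y, (A y.1 - ‖y.2 - u₀ y.1‖ ^ 2 / (2 * θ₀ y.1)) ∂(empiricalMeasure z)) =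
      fun z => (n : ℝ)⁻¹ * ∑ i, A (z i).1 - (n : ℝ)⁻¹ * ∑ i, (2 * θ₀ (z i).1)⁻¹ * ‖(z i).2 - u₀ (z i).1‖ ^ 2 :=
    funext fun z => integral_empiricalMeasure_logProfile A θ₀ u₀ z
  have h1m : Measurable fun z : Config n (Fin 3) T3 => (n : ℝ)⁻¹ * ∑ i, A (z i).1 :=
    measurable_const.mul (Finset.measurable_sum _ fun i _ => hAm.comp (measurable_pi_apply i).fst)
  have h1b : ∀ z : Config n (Fin 3) T3, |(n : ℝ)⁻¹ * ∑ i, A (z i).1| ≤ K := fun z =>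
    abs_avg_le hn hAK fun i => (z i).1
  have hint1 : Integrable (fun z : Config n (Fin 3) T3 => (n : ℝ)⁻¹ * ∑ i, A (z i).1) Q :=
    Integrable.of_bound h1m.aestronglyMeasurable K (Eventually.of_forall fun z =>
      (Real.norm_eq_abs _).trans_le (h1b z))
  have hint2' : Integrable (fun z : Config n (Fin 3) T3 =>
      (n : ℝ)⁻¹ * ∑ i, (2 * θ₀ (z i).1)⁻¹ * ‖(z i).2 - u₀ (z i).1‖ ^ 2) Q := hint2.const_mul _
  rw [hfun]
  refine ⟨hint1.sub hint2', ?_⟩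
  have e2 : ∫ z, (n : ℝ)⁻¹ * ∑ i, (2 * θ₀ (z i).1)⁻¹ * ‖(z i).2 - u₀ (z i).1‖ ^ 2 ∂Q = 3 / 2 := by
    rw [integral_const_mul, hval2]
    have hn' : (n : ℝ) ≠ 0 := by exact_mod_cast hn.ne'
    field_simp
  rw [integral_sub hint1 hint2', e2, integral_avg_positions_canonicalLaw ha hθ hu ha0 hθ0 ε n hAm]

/-- **THE MEAN OF THE EMPIRICAL LOG-PROFILE, registered form** (helper stub `generalFamilyLogProfileMean` of crux
stmt-AtomisticToContinuum-12502, line `means-pin-entropy`; the statement of `integral_logProfileMean_canonicalLaw` as one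
closed proposition). [folklore] -/
theorem generalFamilyLogProfileMean : ∀ {a₀ θ₀ : T3 → ℝ} {u₀ : T3 → V3}, Measurable a₀ → Measurable θ₀ → Measurable u₀ → (∀ x, 0 ≤ a₀ x) → ∀ {Aa : ℝ}, (∀ x, a₀ x ≤ Aa) → (∀ x, 0 < θ₀ x) → ∀ {ε : ℝ} {n : ℕ}, 0 < n → 0 < posPartition a₀ ε n → ∀ {A : T3 → ℝ}, Measurable A → ∀ {K : ℝ}, (∀ x, |A x| ≤ K) → MeasureTheory.Integrable (fun z : Config n (Fin 3) T3 => ∫ y, (A y.1 - ‖y.2 - u₀ y.1‖ ^ 2 / (2 * θ₀ y.1)) ∂(empiricalMeasure z)) (MeasureTheory.volume.withDensity fun z => ENNReal.ofReal (canonicalDensity (Torus.geometry (Fin 3)) ε n (localGibbsProfile a₀ u₀ θ₀) z)) ∧ ∫ z, (∫ y, (A y.1 - ‖y.2 - u₀ y.1‖ ^ 2 / (2 * θ₀ y.1)) ∂(empiricalMeasure z)) ∂(MeasureTheory.volume.withDensity fun z => ENNReal.ofReal (canonicalDensity (Torus.geometry (Fin 3)) ε n (localGibbsProfile a₀ u₀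 θ₀) z)) = ((posPartition a₀ ε n)⁻¹ * ∫ x, posWeight a₀ ε n x * ((n : ℝ)⁻¹ * ∑ i, A (x i))) - 3 / 2 :=
  fun ha hθ hu ha0 _ hAa hθ0 _ _ hn hZ _ hAm _ hAK =>
    integral_logProfileMean_canonicalLaw ha hθ hu ha0 hAa hθ0 hn hZ hAm hAK

end Summit.AtomisticToContinuum.HydrodynamicLimit.Theorems.NearConstantShortTimeHL

end
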